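import Summits.BirchSwinnertonDyer.BirchSwinnertonDyer.Theorems.KatoDescentPotSupersingularReducibleReflectionCoreTwo
import Summits.BirchSwinnertonDyer.BirchSwinnertonDyer.Theorems.KatoDescentPotSupersingularReducibleRelativeClassNumberDoors
import HarnessLib

/-!
# THE REFLECTION DOORS of crux M, second orientation (`χ₂` ODD, `ℚ(P′)` imaginary — e.g. the K8-t′ rows at `p = 5` with an imaginary
# cyclic quartic `ℚ(P′)`): (A) at `(W, p)` from the ODD side ALONE — (i) ONE integer `p ∤ #ker (N : Cl_{K₂} → Cl_{K₂^{σ₀}})` (`= h⁻(ℚ(χ₂))`),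
# or (ii) the layer-zero eigen-test + eigenCLASS test on `K₂`; the EVEN field `ℚ(P)`'s eigen-test is DISCHARGED by Leopoldt reflection
# (`…ReducibleReflectionCoreTwo`; companions of `…ReducibleReflectionDoors` = the `χ₁`-odd orientation)
# (route-free helpers for crux M = stmt-BirchSwinnertonDyer-19196 `ReducibleKatoMember`, K9 / K8-t′; seat `bsd-potss-rkm` g41)

* `fineSelmerDual_moduleFinite_of_reducible_of_relNorm_odd₂_reflection` — `χ₂` ODD (`τ₀ ∈ Γ_ℚ` a complex conjugation of `L = ℚ(χ₁,χ₂)` with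
  `τ₀P₂ − (p−1)P₂ ∈ C`, restricting to `σ₀` on a subfield `K₂` whose fixator fixes `P₂ mod C`), datum `p ∤ #ker (N : Cl_{K₂} → Cl_{K₂^{σ₀}})`,
  plus `χ₁ ≠ 1` and the two decomposition conditions above `p`: statement (A) at `(W, p)` — NO hypothesis on the even field `ℚ(P)`.
* `fineSelmerDual_moduleFinite_of_reducible_of_eigenTests_odd₂_reflection` — the same with the odd side supplied by g39's layer-zero
  eigen-test together with the eigenclass test on `K₂`.
HONEST FRAMING.  Theorems only; route-free; closes nothing: crux M stays cite-level over {Fine, H2X⁺, modularity} ⊕ `H_IC`; no class number is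
computed in Lean; BSD is proved for no curve.  References: [Washington1997] §10.2 Thm. 10.9/10.11, Thm. 10.1; [Lang1990] Ch. 13 §2 Thm. 2.1,
Ch. 3 §4 Thm. 4.4; [CoatesSujatha2005] Thm. 3.4, Cor. 3.6; [DeoRaySujatha2023] §3 Thm. 3.8; [Serre1972] §4.
-/

-- the summit and its single problem are both named `BirchSwinnertonDyer` (registry layout D-0017)
set_option linter.dupNamespace false
set_option autoImplicit false

noncomputable section

open scoped Classical Pointwise NumberField nonZeroDivisors
open Field NumberField IsDedekindDomain IntermediateField WeierstrassCurve
open Literature.NumberTheory.EllipticCurves Literature.NumberTheory.EllipticCurves.GreenbergSelmer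
open Literature.NumberTheory.GaloisRepresentations Literature.NumberTheory.IwasawaTheory Literature.NumberTheory.NumberFields
open Literature.NumberTheory.EllipticCurves.FineSelmerReducibleIsotypic Literature.NumberTheory.EllipticCurves.CoatesSujatha2005
open Literature.NumberTheory.EllipticCurves.ZpExtension
open Summit.BirchSwinnertonDyer.BirchSwinnertonDyer.Theorems
open Summit.BirchSwinnertonDyer.BirchSwinnertonDyer.Theorems.ReducibleFineSelmerCharacterFields
open Summit.BirchSwinnertonDyer.BirchSwinnertonDyer.Theorems.ReducibleFineSelmerLayerZero
open Summit.BirchSwinnertonDyer.BirchSwinnertonDyer.Theorems.ReducibleFineSelmerRelativeClassNumber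

namespace Summit.BirchSwinnertonDyer.BirchSwinnertonDyer.Theorems.ReducibleFineSelmerReflection

section DoorsTwo

variable (W : WeierstrassCurve ℚ) [W.IsElliptic] {p : ℕ} [Fact p.Prime]

/-- **(A) on a reducible row over `ℚ` from ONE odd-side integer, second orientation: side 2 (`χ₂` on `W[p]/C`, ODD) by the
RELATIVE-NORM integer, side 1 (`χ₁` on `C`, EVEN) by LEOPOLDT REFLECTION — no hypothesis on `Cl(ℚ(P))`.**  Data: a subfield `K₂ ⊆ L`
whose fixator fixes `P₂ mod C` (e.g. the canonical `ℚ(P′)`); `τ₀ ∈ Γ_ℚ` inducing a complex conjugation on `L` with `τ₀P₂ − (p−1)P₂ ∈ C`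
(`χ₂` ODD), restricting to `σ₀ ∈ Aut(K₂)`; `p ∤ #ker (N : Cl_{K₂} → Cl_{K₂^{σ₀}})` (`= h⁻(K₂)` for `K₂` imaginary abelian); `χ₁ ≠ 1`;
`C^{D_p} = 0`, `(W[p]/C)^{D_p} = 0`.  Proof: g40's door `…_of_relNorm_or_layerZero_or_doors`, side 1's eigen-test at the canonical `K₁ = ℚ(P)`
supplied by the reflection core (second orientation) with the eigenclass test on `K₂` discharged by the relative-norm kill.
[cite: Washington1997, §10.2, Thm. 10.9 and Thm. 10.11; Thm. 10.1] [cite: Lang1990, Ch. 13 §2, Thm. 2.1; Ch. 3 §4, Thm. 4.4]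
[cite: CoatesSujatha2005, §3 Thm. 3.4, Lemma 3.8 and Cor. 3.6] [cite: DeoRaySujatha2023, §3 Thm. 3.8 (c2), (c3) and §5 Lemma 5.1] -/
theorem fineSelmerDual_moduleFinite_of_reducible_of_relNorm_odd₂_reflection (hp : p ≠ 2)
    (κ : ZpExtension ℚ p) (hκ : κ.IsCyclotomic)
    (C : AddSubgroup (W.geomTorsion (p : ℤ)))
    (hC : ∀ (σ : absoluteGaloisGroup ℚ) (x : W.geomTorsion (p : ℤ)), x ∈ C → σ • x ∈ C)
    (h1 : C ≠ ⊥) (h2 : C ≠ ⊤)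
    (P : W.geomTorsion (p : ℤ)) (hPC : P ∈ C) (hP0 : P ≠ 0)
    (P₂ : W.geomTorsion (p : ℤ)) (hP₂ : P₂ ∉ C)
    (K₂ : haveI : NeZero p := ⟨(Fact.out : p.Prime).ne_zero⟩
      haveI := isGalois_borelField (W := W) hC
      IntermediateField ℚ (W.borelField C))
    (hK₂ : NumberField K₂)
    (hK₂P : haveI : NeZero p := ⟨(Fact.out : p.Prime).ne_zero⟩
      haveI := isGalois_borelField (W := W) hC
      ∀ τ : absoluteGaloisGroup ℚ,
        (∀ x : K₂, absRestrictNormalHom (W.borelField C) τ (x : W.borelField C) = x) → τ • P₂ - P₂ ∈ C)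
    (τ₀ : absoluteGaloisGroup ℚ)
    (hτ₀ : haveI : NeZero p := ⟨(Fact.out : p.Prime).ne_zero⟩
      haveI := isGalois_borelField (W := W) hC
      ∃ φ : ↥(W.borelField C) →+* ℂ, ∀ x : ↥(W.borelField C),
        φ (absRestrictNormalHom (W.borelField C) τ₀ x) = starRingEnd ℂ (φ x))
    (hτP₂ : τ₀ • P₂ - (p - 1) • P₂ ∈ C)
    (σ₀ : K₂ ≃ₐ[ℚ] K₂)
    (hσ₀ : haveI : NeZero p := ⟨(Fact.out : p.Prime).ne_zero⟩
      haveI := isGalois_borelField (W := W) hC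
      ∀ x : K₂, absRestrictNormalHom (W.borelField C) τ₀ (x : W.borelField C) = ((σ₀ x : K₂) : W.borelField C))
    (hrel₂ : haveI := hK₂
      ¬ p ∣ Nat.card (classGroupNorm ↥(fixedField (Subgroup.zpowers σ₀)) K₂).ker)
    (hne₁ : ∃ τ : absoluteGaloisGroup ℚ, τ • P ≠ P)
    (hD₁ : ∀ v : HeightOneSpectrum (𝓞 ℚ), ((p : ℕ) : 𝓞 ℚ) ∈ v.asIdeal →
      ∀ w : W.geomTorsion (p : ℤ), w ∈ C → (∀ d ∈ GreenbergSelmer.decomp v, d • w = w) → w = 0)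
    (hD₂ : ∀ v : HeightOneSpectrum (𝓞 ℚ), ((p : ℕ) : 𝓞 ℚ) ∈ v.asIdeal →
      ∀ m : W.geomTorsion (p : ℤ), (∀ d ∈ GreenbergSelmer.decomp v, d • m - m ∈ C) → m ∈ C) :
    ∃ (γ : absoluteGaloisGroup ℚ) (D : W.FineSelmerDualData κ γ),
      Module.Finite ℤ_[p] (RestrictScalars ℤ_[p] (IwasawaAlgebra p) D.X) := by
  have hpr : p.Prime := Fact.out
  haveI : NeZero p := ⟨hpr.ne_zero⟩
  haveI := isGalois_borelField (W := W) hC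
  haveI := hK₂
  have hmodp1 : (p - 1) % p = p - 1 := Nat.mod_eq_of_lt (Nat.sub_lt hpr.pos Nat.one_pos)
  have ha : ¬ (p - 1) ≡ 1 [MOD p] := by
    intro h
    have h' : (p - 1) % p = 1 % p := h
    rw [hmodp1, Nat.mod_eq_of_lt hpr.one_lt] at h'
    omega
  /- the canonical even field `K₁ = ℚ(P)` -/
  let K₁ : IntermediateField ℚ ↥(W.borelField C) :=
    fixedField ((fixingSubgroup (absoluteGaloisGroup ℚ) (C : Set (W.geomTorsion (p : ℤ)))).map
      (absRestrictNormalHom (W.borelField C)))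
  haveI hK₁nf : NumberField ↥K₁ := numberField_intermediateField_borelField W C K₁
  have hV : Nat.card (W.geomTorsion (p : ℤ)) = p ^ 2 := W.natCard_geomTorsion_eq_sq_of_charZero hpr
  have hcard : Nat.card C = p := W.card_eq_of_ne_bot_of_ne_top hV h1 h2
  have hab : IsAbelianGalois ℚ ↥(W.borelField C) := isAbelianGalois_borelField (W := W) hC hcard hV
  haveI : IsAbelianGalois ℚ ↥K₂ := @IsAbelianGalois.tower_bot ℚ ↥K₂ ↥(W.borelField C) _ _ _ _ _ _ _ hab
  -- the eigenclass test on `K₂` from the relative-norm integer: `σ₀ • x = x^{p-1}`, `p - 1 ≢ 1`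
  let σ₁ : ↥K₂ ≃ₐ[↥(fixedField (Subgroup.zpowers σ₀))] ↥K₂ :=
    { σ₀.toRingEquiv with
      commutes' := fun e => by
        obtain ⟨e, he⟩ := e
        exact (IntermediateField.mem_fixedField_iff (Subgroup.zpowers σ₀) e).mp he σ₀ (Subgroup.mem_zpowers σ₀) }
  have hkill₂ : ∀ x : ClassGroup (𝓞 ↥K₂), x ^ p = 1 →
      (∀ (τ : absoluteGaloisGroup ℚ) (σ : ↥K₂ ≃ₐ[ℚ] ↥K₂) (a : ℕ),
        (∀ y : ↥K₂, absRestrictNormalHom (W.borelField C) τ (y : W.borelField C) = ((σ y : ↥K₂) : W.borelField C)) →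
        τ • P₂ - a • P₂ ∈ C → ClassGroup.mulEquiv (AmbiguousClass.intAut σ) x = x ^ a) → x = 1 := by
    intro x hxp H
    have h := H τ₀ σ₀ (p - 1) hσ₀ hτP₂
    have h' : ClassGroup.mulEquiv (AmbiguousClass.intAut σ₁) x = x ^ (p - 1) := h
    exact classGroup_eq_one_of_smul_eq_pow_of_not_dvd_card_ker ↥(fixedField (Subgroup.zpowers σ₀)) ↥K₂ hpr σ₁ hrel₂ hxp ha h'
  refine fineSelmerDual_moduleFinite_of_not_irreducible_of_relNorm_or_layerZero_or_doors hp W κ hκ C hC h1 h2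
    (Or.inr (Or.inl ⟨⟨K₁, hK₁nf, P, hPC, hP0, fun τ hτ => smul_eq_of_forall_fixedField_line W C hC τ hτ P hPC, ?_⟩, hD₁⟩))
    (Or.inl ⟨⟨K₂, hK₂, P₂, σ₀, τ₀, p - 1, hP₂, hK₂P, hσ₀, hτP₂, ha, hrel₂⟩, hD₂⟩)
  exact eigenTest_even₁_of_eigenClass_test_odd₂ W hp C hC h1 h2 P hPC hP0 P₂ hP₂ K₁ hK₁nf K₂ hK₂ hK₂P τ₀ hτ₀ hτP₂ hne₁ hkill₂

/-- **(A) on a reducible row over `ℚ` with `χ₂` ODD from the odd field's LAYER-ZERO DATA ALONE: side 2 by g39's eigen-test on a subfield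
`K₂` fixing `P₂ mod C` TOGETHER WITH the eigenclass test on `K₂`, side 1 (EVEN) by LEOPOLDT REFLECTION — no hypothesis on `Cl(ℚ(P))`.**
[cite: Washington1997, §10.2, Thm. 10.9 and Thm. 10.11] [cite: Lang1990, Ch. 13 §2, Thm. 2.1]
[cite: CoatesSujatha2005, §3 Thm. 3.4, Lemma 3.8 and Cor. 3.6] [cite: DeoRaySujatha2023, §3 Thm. 3.8 (c2), (c3) and §5 Lemma 5.1] -/
theorem fineSelmerDual_moduleFinite_of_reducible_of_eigenTests_odd₂_reflection (hp : p ≠ 2)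
    (κ : ZpExtension ℚ p) (hκ : κ.IsCyclotomic)
    (C : AddSubgroup (W.geomTorsion (p : ℤ)))
    (hC : ∀ (σ : absoluteGaloisGroup ℚ) (x : W.geomTorsion (p : ℤ)), x ∈ C → σ • x ∈ C)
    (h1 : C ≠ ⊥) (h2 : C ≠ ⊤)
    (P : W.geomTorsion (p : ℤ)) (hPC : P ∈ C) (hP0 : P ≠ 0)
    (P₂ : W.geomTorsion (p : ℤ)) (hP₂ : P₂ ∉ C)
    (K₂ : haveI : NeZero p := ⟨(Fact.out : p.Prime).ne_zero⟩
      haveI := isGalois_borelField (W := W) hC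
      IntermediateField ℚ (W.borelField C))
    (hK₂ : NumberField K₂)
    (hK₂P : haveI : NeZero p := ⟨(Fact.out : p.Prime).ne_zero⟩
      haveI := isGalois_borelField (W := W) hC
      ∀ τ : absoluteGaloisGroup ℚ,
        (∀ x : K₂, absRestrictNormalHom (W.borelField C) τ (x : W.borelField C) = x) → τ • P₂ - P₂ ∈ C)
    (τ₀ : absoluteGaloisGroup ℚ)
    (hτ₀ : haveI : NeZero p := ⟨(Fact.out : p.Prime).ne_zero⟩
      haveI := isGalois_borelField (W := W) hC
      ∃ φ : ↥(W.borelField C) →+* ℂ, ∀ x : ↥(W.borelField C),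
        φ (absRestrictNormalHom (W.borelField C) τ₀ x) = starRingEnd ℂ (φ x))
    (hτP₂ : τ₀ • P₂ - (p - 1) • P₂ ∈ C)
    (hEig₂ : haveI : NeZero p := ⟨(Fact.out : p.Prime).ne_zero⟩
      haveI := isGalois_borelField (W := W) hC
      haveI := hK₂
      ∀ μ : Additive (ClassGroup (𝓞 K₂)) →+ ZMod p,
        (∀ (τ : absoluteGaloisGroup ℚ) (σ : K₂ ≃ₐ[ℚ] K₂) (a : ℕ),
          (∀ x : K₂, absRestrictNormalHom (W.borelField C) τ (x : W.borelField C) = ((σ x : K₂) : W.borelField C)) →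
          τ • P₂ - a • P₂ ∈ C →
          ∀ (I J : (Ideal (𝓞 K₂))⁰),
            (J : Ideal (𝓞 K₂)) = (I : Ideal (𝓞 K₂)).map (AmbiguousClass.intAut σ : 𝓞 K₂ →+* 𝓞 K₂) →
            μ (Additive.ofMul (ClassGroup.mk0 J)) = a • μ (Additive.ofMul (ClassGroup.mk0 I))) →
        μ = 0)
    (hEigCl₂ : haveI : NeZero p := ⟨(Fact.out : p.Prime).ne_zero⟩
      haveI := isGalois_borelField (W := W) hC
      haveI := hK₂
      ∀ x : ClassGroup (𝓞 K₂), x ^ p = 1 →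
        (∀ (τ : absoluteGaloisGroup ℚ) (σ : K₂ ≃ₐ[ℚ] K₂) (a : ℕ),
          (∀ y : K₂, absRestrictNormalHom (W.borelField C) τ (y : W.borelField C) = ((σ y : K₂) : W.borelField C)) →
          τ • P₂ - a • P₂ ∈ C → ClassGroup.mulEquiv (AmbiguousClass.intAut σ) x = x ^ a) → x = 1)
    (hne₁ : ∃ τ : absoluteGaloisGroup ℚ, τ • P ≠ P)
    (hD₁ : ∀ v : HeightOneSpectrum (𝓞 ℚ), ((p : ℕ) : 𝓞 ℚ) ∈ v.asIdeal →
      ∀ w : W.geomTorsion (p : ℤ), w ∈ C → (∀ d ∈ GreenbergSelmer.decomp v, d • w = w) → w = 0)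
    (hD₂ : ∀ v : HeightOneSpectrum (𝓞 ℚ), ((p : ℕ) : 𝓞 ℚ) ∈ v.asIdeal →
      ∀ m : W.geomTorsion (p : ℤ), (∀ d ∈ GreenbergSelmer.decomp v, d • m - m ∈ C) → m ∈ C) :
    ∃ (γ : absoluteGaloisGroup ℚ) (D : W.FineSelmerDualData κ γ),
      Module.Finite ℤ_[p] (RestrictScalars ℤ_[p] (IwasawaAlgebra p) D.X) := by
  have hpr : p.Prime := Fact.out
  haveI : NeZero p := ⟨hpr.ne_zero⟩
  haveI := isGalois_borelField (W := W) hC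
  haveI := hK₂
  let K₁ : IntermediateField ℚ ↥(W.borelField C) :=
    fixedField ((fixingSubgroup (absoluteGaloisGroup ℚ) (C : Set (W.geomTorsion (p : ℤ)))).map
      (absRestrictNormalHom (W.borelField C)))
  haveI hK₁nf : NumberField ↥K₁ := numberField_intermediateField_borelField W C K₁
  refine fineSelmerDual_moduleFinite_of_not_irreducible_of_relNorm_or_layerZero_or_doors hp W κ hκ C hC h1 h2
    (Or.inr (Or.inl ⟨⟨K₁, hK₁nf, P, hPC, hP0, fun τ hτ => smul_eq_of_forall_fixedField_line W C hC τ hτ P hPC, ?_⟩, hD₁⟩))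
    (Or.inr (Or.inl ⟨⟨K₂, hK₂, P₂, hP₂, hK₂P, hEig₂⟩, hD₂⟩))
  exact eigenTest_even₁_of_eigenClass_test_odd₂ W hp C hC h1 h2 P hPC hP0 P₂ hP₂ K₁ hK₁nf K₂ hK₂ hK₂P τ₀ hτ₀ hτP₂ hne₁ hEigCl₂

end DoorsTwo

end Summit.BirchSwinnertonDyer.BirchSwinnertonDyer.Theorems.ReducibleFineSelmerReflection

end
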